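import Literature.Probability.Percolation.KozmaNitzanPreFKG
import HarnessLib

/-!
# `NoHeavyLowerTail` (stmt-CriticalPhenomena-4575) — BHK 2006 Theorem 1.1 in event form: log-supermodularity of the
# cluster law in the AVOIDED SET ("MIX rows")

Support file (prover `prim-lf-3`, lemma factory #3 = submodularity; `--supports stmt-CriticalPhenomena-4575 --as helper`).
No definitions, no named facts, no sorries.

Van den Berg–Häggström–Kahn 2006, Theorem 1.1 [VandenbergHaggstromKahn2005, Thm. 1.1 p. 4] (= van den Berg–Kahn 2001 Thm 1.2
generalised): for a vertex `s`, events `A, B` increasing and determined by the open cluster `C_s`, and ANY vertex sets `X, Y`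
(not containing `s`),
  `μ(A ∩ R_X) · μ(B ∩ R_Y) ≤ μ(A ∩ B ∩ R_{X ∩ Y}) · μ(R_{X ∪ Y})`,   `R_X := {s ↮ x ∀ x ∈ X}`.
The tree vendors Theorem 1.3 (the case `X = Y`, `BHK2006_clusterConditionalPositiveAssociation_holds`, event forms
`KNPreFKG.bhk_one_upper_upper / bhk_one_upper_lower`); here Theorem 1.1 is DERIVED from it exactly as in BHK's Remark 2 on
p. 8: conditionally on `D = R_{X∩Y}` the pairs `(A, R_{X∖Y})`, `(B, R_{Y∖X})` are negatively correlated and `(A, B)`,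
`(R_{X∖Y}, R_{Y∖X})` positively correlated, and the four inequalities multiply to (1.1).

* `MixedAvoidance.bhk_one_lower_lower` — Thm 1.3 event form for two LOWER families (complements of the upper/upper case);
* `MixedAvoidance.bhk_one_mixed` — **Theorem 1.1 in event form** for upper families `𝒜, ℬ` read on `C_s` and vertex sets `X, Y`.

Why here (crux line): as a PRIMITIVE quadratic row on partition masses — e.g. the pocket form
`μ(π_s = T)·μ(π_s = T') ≤ μ(π_s = T ∪ T')·μ(π_s ⊆ T ∩ T')` — it is not a degree-2 consequence of the single-conditioning-set
rows used by the certificate LPs of the CIL/GTP/(U1) lines (it is a degree-4 chain of them); memo CANDIDATES.md 'MIX rows',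
ttrl request `lf3-mix-rows-bhk11`.
-/

noncomputable section

open MeasureTheory Set
open Literature.Probability.LatticeModels (prodBernoulli)
open Literature.Probability.Percolation Literature.Probability.Percolation.KNPreFKG

namespace Summit.CriticalPhenomena.PercolationContinuityZ3.Theorems

namespace MixedAvoidance

variable {V : Type*} [Fintype V]

/-- **BHK 2006, Thm. 1.3, event form (decreasing × decreasing).** For `s ∉ X`, `D = {s ↮ X}`, `𝒬, 𝒬'` lower
families read on `C_s`: `μ(D ∩ {C_s ∈ 𝒬}) · μ(D ∩ {C_s ∈ 𝒬'}) ≤ μ(D) · μ(D ∩ {C_s ∈ 𝒬} ∩ {C_s ∈ 𝒬'})`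
(from the upper × upper case applied to the complementary families).
[cite: VandenbergHaggstromKahn2005, Thm. 1.3 (p. 6) and Remark 2 (p. 8)] -/
theorem bhk_one_lower_lower (w : Sym2 V → unitInterval) (s : V) (X : Set V) (hs : s ∉ X)
    {𝒬 𝒬' : Set (Set (Sym2 V))} (h𝒬 : IsLowerSet 𝒬) (h𝒬' : IsLowerSet 𝒬') :
    (prodBernoulli w).real ({ω : BondConfig V | ∀ x ∈ X, ¬ (openGraph ω).Reachable s x} ∩
        {ω | openEdgeCluster ω s ∈ 𝒬}) *
      (prodBernoulli w).real ({ω : BondConfig V | ∀ x ∈ X, ¬ (openGraph ω).Reachable s x} ∩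
        {ω | openEdgeCluster ω s ∈ 𝒬'}) ≤
    (prodBernoulli w).real {ω : BondConfig V | ∀ x ∈ X, ¬ (openGraph ω).Reachable s x} *
      (prodBernoulli w).real ({ω : BondConfig V | ∀ x ∈ X, ¬ (openGraph ω).Reachable s x} ∩
        ({ω | openEdgeCluster ω s ∈ 𝒬} ∩ {ω | openEdgeCluster ω s ∈ 𝒬'})) := by
  classical
  set μ := prodBernoulli w with hμ
  set D : Set (BondConfig V) := {ω : BondConfig V | ∀ x ∈ X, ¬ (openGraph ω).Reachable s x} with hD
  set E : Set (BondConfig V) := {ω | openEdgeCluster ω s ∈ 𝒬} with hE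
  set E' : Set (BondConfig V) := {ω | openEdgeCluster ω s ∈ 𝒬'} with hE'
  have hmeas : ∀ S : Set (BondConfig V), MeasurableSet S := fun S => (Set.toFinite S).measurableSet
  -- complementary upper families
  have hup : IsUpperSet 𝒬ᶜ := fun a b hab ha hb => ha (h𝒬 hab hb)
  have hup' : IsUpperSet 𝒬'ᶜ := fun a b hab ha hb => ha (h𝒬' hab hb)
  have key := bhk_one_upper_upper w s X hs hup hup'
  have hEc : {ω : BondConfig V | openEdgeCluster ω s ∈ 𝒬ᶜ} = Eᶜ := by ext ω; simp [hE]
  have hEc' : {ω : BondConfig V | openEdgeCluster ω s ∈ 𝒬'ᶜ} = E'ᶜ := by ext ω; simp [hE']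
  rw [hEc, hEc'] at key
  -- inclusion–exclusion inside `D`
  have h1 : μ.real (D ∩ Eᶜ) = μ.real D - μ.real (D ∩ E) := by
    rw [← measureReal_inter_add_sdiff (μ := μ) (s := D) (hmeas E)]
    have : D \ E = D ∩ Eᶜ := by rw [sdiff_eq]
    rw [this]; ring
  have h2 : μ.real (D ∩ E'ᶜ) = μ.real D - μ.real (D ∩ E') := by
    rw [← measureReal_inter_add_sdiff (μ := μ) (s := D) (hmeas E')]
    have : D \ E' = D ∩ E'ᶜ := by rw [sdiff_eq]
    rw [this]; ring
  have h3 : μ.real (D ∩ (Eᶜ ∩ E'ᶜ)) = μ.real D - μ.real (D ∩ E) - μ.real (D ∩ E') + μ.real (D ∩ (E ∩ E')) := by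
    have hsplit1 : μ.real (D ∩ Eᶜ) = μ.real (D ∩ Eᶜ ∩ E') + μ.real ((D ∩ Eᶜ) \ E') :=
      (measureReal_inter_add_sdiff (μ := μ) (s := D ∩ Eᶜ) (hmeas E')).symm
    have hsplit2 : μ.real (D ∩ E') = μ.real (D ∩ E' ∩ E) + μ.real ((D ∩ E') \ E) :=
      (measureReal_inter_add_sdiff (μ := μ) (s := D ∩ E') (hmeas E)).symm
    have e1 : (D ∩ Eᶜ) \ E' = D ∩ (Eᶜ ∩ E'ᶜ) := by
      ext ω; simp only [mem_sdiff, mem_inter_iff, mem_compl_iff]; tauto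
    have e2 : (D ∩ E') \ E = D ∩ Eᶜ ∩ E' := by
      ext ω; simp only [mem_sdiff, mem_inter_iff, mem_compl_iff]; tauto
    have e3 : D ∩ E' ∩ E = D ∩ (E ∩ E') := by
      ext ω; simp only [mem_inter_iff]; tauto
    rw [e1] at hsplit1; rw [e2, e3] at hsplit2
    linarith
  rw [h1, h2, h3] at key
  nlinarith [key, measureReal_nonneg (μ := μ) (s := D)]

/-- **BHK 2006, Theorem 1.1, event form (mixed avoided sets).**  For `s ∉ X`, any `Y` (for `s ∈ Y` the left side
vanishes) and upper families `𝒜, ℬ` read on the open cluster `C_s`: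
`μ(R_X ∩ {C_s ∈ 𝒜}) · μ(R_Y ∩ {C_s ∈ ℬ}) ≤ μ(R_{X∩Y} ∩ ({C_s ∈ 𝒜} ∩ {C_s ∈ ℬ})) · μ(R_{X∪Y})`, `R_X = {s ↮ x ∀ x ∈ X}`.
Derived from Thm 1.3 (event forms) by BHK's Remark 2, p. 8. [cite: VandenbergHaggstromKahn2005, Thm. 1.1 (p. 4); Remark 2 (p. 8)] -/
theorem bhk_one_mixed (w : Sym2 V → unitInterval) (s : V) (X Y : Set V) (hsX : s ∉ X)
    {𝒜 ℬ : Set (Set (Sym2 V))} (h𝒜 : IsUpperSet 𝒜) (hℬ : IsUpperSet ℬ) :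
    (prodBernoulli w).real ({ω : BondConfig V | ∀ x ∈ X, ¬ (openGraph ω).Reachable s x} ∩
        {ω | openEdgeCluster ω s ∈ 𝒜}) *
      (prodBernoulli w).real ({ω : BondConfig V | ∀ x ∈ Y, ¬ (openGraph ω).Reachable s x} ∩
        {ω | openEdgeCluster ω s ∈ ℬ}) ≤
    (prodBernoulli w).real ({ω : BondConfig V | ∀ x ∈ X ∩ Y, ¬ (openGraph ω).Reachable s x} ∩
        ({ω | openEdgeCluster ω s ∈ 𝒜} ∩ {ω | openEdgeCluster ω s ∈ ℬ})) *
      (prodBernoulli w).real {ω : BondConfig V | ∀ x ∈ X ∪ Y, ¬ (openGraph ω).Reachable s x} := by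
  classical
  set μ := prodBernoulli w with hμ
  set D : Set (BondConfig V) := {ω : BondConfig V | ∀ x ∈ X ∩ Y, ¬ (openGraph ω).Reachable s x} with hD
  set A : Set (BondConfig V) := {ω | openEdgeCluster ω s ∈ 𝒜} with hA
  set B : Set (BondConfig V) := {ω | openEdgeCluster ω s ∈ ℬ} with hB
  -- the avoided-set events as lower families read on `C_s`
  set E : Set (BondConfig V) := {ω | openEdgeCluster ω s ∈ disconnFamily s (X \ Y)} with hE
  set E' : Set (BondConfig V) := {ω | openEdgeCluster ω s ∈ disconnFamily s (Y \ X)} with hE'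
  have hsXY : s ∉ X ∩ Y := fun h => hsX h.1
  have hmeas : ∀ S : Set (BondConfig V), MeasurableSet S := fun S => (Set.toFinite S).measurableSet
  have hEeq : {ω : BondConfig V | ∀ x ∈ X \ Y, ¬ (openGraph ω).Reachable s x} = E :=
    setOf_forall_not_reachable_eq s (X \ Y)
  have hE'eq : {ω : BondConfig V | ∀ x ∈ Y \ X, ¬ (openGraph ω).Reachable s x} = E' :=
    setOf_forall_not_reachable_eq s (Y \ X)
  -- set identities: R_X = D ∩ E, R_Y = D ∩ E', R_{X∪Y} = D ∩ (E ∩ E')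
  have hRX : {ω : BondConfig V | ∀ x ∈ X, ¬ (openGraph ω).Reachable s x} = D ∩ E := by
    rw [← hEeq]; ext ω; simp only [mem_setOf_eq, mem_inter_iff, mem_sdiff, hD]
    constructor
    · intro h; exact ⟨fun x hx => h x hx.1, fun x hx => h x hx.1⟩
    · rintro ⟨h1, h2⟩ x hx
      by_cases hy : x ∈ Y
      · exact h1 x ⟨hx, hy⟩
      · exact h2 x ⟨hx, hy⟩
  have hRY : {ω : BondConfig V | ∀ x ∈ Y, ¬ (openGraph ω).Reachable s x} = D ∩ E' := by
    rw [← hE'eq]; ext ω; simp only [mem_setOf_eq, mem_inter_iff, mem_sdiff, hD]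
    constructor
    · intro h; exact ⟨fun x hx => h x hx.2, fun x hx => h x hx.1⟩
    · rintro ⟨h1, h2⟩ x hx
      by_cases hx' : x ∈ X
      · exact h1 x ⟨hx', hx⟩
      · exact h2 x ⟨hx, hx'⟩
  have hRXY : {ω : BondConfig V | ∀ x ∈ X ∪ Y, ¬ (openGraph ω).Reachable s x} = D ∩ (E ∩ E') := by
    rw [← hEeq, ← hE'eq]; ext ω; simp only [mem_setOf_eq, mem_inter_iff, mem_sdiff, mem_union, hD]
    constructor
    · intro h
      exact ⟨fun x hx => h x (Or.inl hx.1), fun x hx => h x (Or.inl hx.1), fun x hx => h x (Or.inr hx.1)⟩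
    · rintro ⟨h1, h2, h3⟩ x hx
      by_cases hxX : x ∈ X
      · by_cases hxY : x ∈ Y
        · exact h1 x ⟨hxX, hxY⟩
        · exact h2 x ⟨hxX, hxY⟩
      · rcases hx with hx | hx
        · exact absurd hx hxX
        · exact h3 x ⟨hx, hxX⟩
  rw [hRX, hRY, hRXY]
  -- the four BHK 1.3 steps, all conditioned on `D = R_{X∩Y}`
  have i1 := bhk_one_upper_lower w s (X ∩ Y) hsXY h𝒜 (isLowerSet_disconnFamily s (X \ Y))
  have i2 := bhk_one_upper_lower w s (X ∩ Y) hsXY hℬ (isLowerSet_disconnFamily s (Y \ X))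
  have i3 := bhk_one_upper_upper w s (X ∩ Y) hsXY h𝒜 hℬ
  have i4 := bhk_one_lower_lower w s (X ∩ Y) hsXY (isLowerSet_disconnFamily s (X \ Y))
    (isLowerSet_disconnFamily s (Y \ X))
  change μ.real D * μ.real (D ∩ (A ∩ E)) ≤ μ.real (D ∩ A) * μ.real (D ∩ E) at i1
  change μ.real D * μ.real (D ∩ (B ∩ E')) ≤ μ.real (D ∩ B) * μ.real (D ∩ E') at i2
  change μ.real (D ∩ A) * μ.real (D ∩ B) ≤ μ.real D * μ.real (D ∩ (A ∩ B)) at i3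
  change μ.real (D ∩ E) * μ.real (D ∩ E') ≤ μ.real D * μ.real (D ∩ (E ∩ E')) at i4
  have eA : D ∩ E ∩ A = D ∩ (A ∩ E) := by ext ω; simp only [mem_inter_iff]; tauto
  have eB : D ∩ E' ∩ B = D ∩ (B ∩ E') := by ext ω; simp only [mem_inter_iff]; tauto
  rw [eA, eB]
  have hDnn : 0 ≤ μ.real D := measureReal_nonneg
  have hAEnn : 0 ≤ μ.real (D ∩ (A ∩ E)) := measureReal_nonneg
  have hBEnn : 0 ≤ μ.real (D ∩ (B ∩ E')) := measureReal_nonneg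
  have hDA : 0 ≤ μ.real (D ∩ A) := measureReal_nonneg
  have hDB : 0 ≤ μ.real (D ∩ B) := measureReal_nonneg
  have hDE : 0 ≤ μ.real (D ∩ E) := measureReal_nonneg
  have hDE' : 0 ≤ μ.real (D ∩ E') := measureReal_nonneg
  have hRHS : 0 ≤ μ.real (D ∩ (A ∩ B)) * μ.real (D ∩ (E ∩ E')) := mul_nonneg measureReal_nonneg measureReal_nonneg
  by_cases hD0 : μ.real D = 0
  · -- then `μ(D ∩ (A ∩ E)) = 0` and the left side vanishes
    have hz : μ.real (D ∩ (A ∩ E)) = 0 :=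
      le_antisymm (le_trans (measureReal_mono inter_subset_left (measure_ne_top _ _)) (le_of_eq hD0)) hAEnn
    rw [hz, zero_mul]; exact hRHS
  · have hDpos : 0 < μ.real D := lt_of_le_of_ne hDnn (Ne.symm hD0)
    -- μ(D)^2 · LHS ≤ (μ(D∩A)μ(D∩E)) (μ(D∩B)μ(D∩E')) ≤ μ(D)^2 · RHS
    have step1 : μ.real D * μ.real (D ∩ (A ∩ E)) * (μ.real D * μ.real (D ∩ (B ∩ E'))) ≤
        (μ.real (D ∩ A) * μ.real (D ∩ E)) * (μ.real (D ∩ B) * μ.real (D ∩ E')) :=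
      mul_le_mul i1 i2 (mul_nonneg hDnn hBEnn) (mul_nonneg hDA hDE)
    have step2 : (μ.real (D ∩ A) * μ.real (D ∩ E)) * (μ.real (D ∩ B) * μ.real (D ∩ E')) =
        (μ.real (D ∩ A) * μ.real (D ∩ B)) * (μ.real (D ∩ E) * μ.real (D ∩ E')) := by ring
    have step3 : (μ.real (D ∩ A) * μ.real (D ∩ B)) * (μ.real (D ∩ E) * μ.real (D ∩ E')) ≤
        (μ.real D * μ.real (D ∩ (A ∩ B))) * (μ.real D * μ.real (D ∩ (E ∩ E'))) :=
      mul_le_mul i3 i4 (mul_nonneg hDE hDE') (mul_nonneg hDnn measureReal_nonneg)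
    have h : μ.real D * μ.real D * (μ.real (D ∩ (A ∩ E)) * μ.real (D ∩ (B ∩ E'))) ≤
        μ.real D * μ.real D * (μ.real (D ∩ (A ∩ B)) * μ.real (D ∩ (E ∩ E'))) := by
      have := le_trans step1 (le_of_eq_of_le step2 step3)
      nlinarith [this]
    have hDD : 0 < μ.real D * μ.real D := mul_pos hDpos hDpos
    exact le_of_mul_le_mul_left h hDD

omit [Fintype V] in
/-- The family of edge sets seeing every vertex of `T` from `s` (an upper family). [folklore] -/
theorem isUpperSet_seesAll (s : V) (T : Finset V) :
    IsUpperSet {C : Set (Sym2 V) | ∀ a ∈ T, C ∈ connFamily s a} := by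
  intro C C' hCC' hC a ha
  exact isUpperSet_connFamily s a hCC' (hC a ha)

omit [Fintype V] in
/-- `{C_s sees all of T} = ⋂_{a ∈ T} {s ↔ a}`. [folklore] -/
theorem mem_seesAll_iff (s : V) (T : Finset V) (ω : BondConfig V) :
    openEdgeCluster ω s ∈ {C : Set (Sym2 V) | ∀ a ∈ T, C ∈ connFamily s a} ↔
      ∀ a ∈ T, (openGraph ω).Reachable s a := by
  simp only [mem_setOf_eq]
  refine forall₂_congr fun a _ => ?_
  have h := congrArg (fun S : Set (BondConfig V) => ω ∈ S) (openConn_eq_setOf_connFamily (V := V) s a)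
  simp only [openConn, mem_setOf_eq, eq_iff_iff] at h
  exact h.symm

omit [Fintype V] in
open scoped Classical in
/-- Pocket events as 'sees all of `T`, avoids `A ∖ T`': for `T ⊆ A`,
`{π_s = T} = {s ↮ A∖T} ∩ {C_s sees all of T}`, where `π_s = {z ∈ A : s ↔ z}`. [folklore] -/
theorem pocket_eq_event (A T : Finset V) (s : V) (hT : T ⊆ A) :
    {ω : BondConfig V | (A.filter fun z => ω ∈ openConn s z) = T} =
      {ω : BondConfig V | ∀ x ∈ ((↑A : Set V) \ ↑T), ¬ (openGraph ω).Reachable s x} ∩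
        {ω | openEdgeCluster ω s ∈ {C : Set (Sym2 V) | ∀ a ∈ T, C ∈ connFamily s a}} := by
  ext ω
  have hc : ∀ a : V, openEdgeCluster ω s ∈ connFamily s a ↔ (openGraph ω).Reachable s a := fun a => by
    have h := congrArg (fun S : Set (BondConfig V) => ω ∈ S) (openConn_eq_setOf_connFamily (V := V) s a)
    simp only [openConn, mem_setOf_eq, eq_iff_iff] at h
    exact h.symm
  simp only [mem_setOf_eq, mem_inter_iff, mem_sdiff, Finset.mem_coe, hc]
  constructor
  · intro h
    constructor
    · rintro x ⟨hxA, hxT⟩ hsx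
      have : x ∈ A.filter fun z => ω ∈ openConn s z := Finset.mem_filter.2 ⟨hxA, hsx⟩
      rw [h] at this; exact hxT this
    · intro a ha
      have : a ∈ A.filter fun z => ω ∈ openConn s z := by rw [h]; exact ha
      exact (Finset.mem_filter.1 this).2
  · rintro ⟨h1, h2⟩
    ext a
    simp only [Finset.mem_filter]
    constructor
    · rintro ⟨haA, hsa⟩
      by_contra haT
      exact h1 a ⟨haA, haT⟩ hsa
    · intro haT; exact ⟨hT haT, h2 a haT⟩

open scoped Classical in
/-- **MIX row, pocket form** (BHK 2006 Thm 1.1 specialised).  For `s ∉ A` and `T, T' ⊆ A`, with `π_s = {z ∈ A : s ↔ z}`: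
`μ(π_s = T) · μ(π_s = T') ≤ μ(π_s = T ∪ T') · μ(π_s ⊆ T ∩ T')` — an observer cannot put mass on two different pockets without
paying on the union pocket and on the pockets inside the intersection.  (For a relay `x` use `A.erase x`.)
[cite: VandenbergHaggstromKahn2005, Thm. 1.1 (p. 4)] -/
theorem pocket_mix (w : Sym2 V → unitInterval) (A T T' : Finset V) (s : V) (hs : s ∉ A) (hT : T ⊆ A) (hT' : T' ⊆ A) :
    (prodBernoulli w).real {ω : BondConfig V | (A.filter fun z => ω ∈ openConn s z) = T} *
      (prodBernoulli w).real {ω : BondConfig V | (A.filter fun z => ω ∈ openConn s z) = T'} ≤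
    (prodBernoulli w).real {ω : BondConfig V | (A.filter fun z => ω ∈ openConn s z) = T ∪ T'} *
      (prodBernoulli w).real {ω : BondConfig V | (A.filter fun z => ω ∈ openConn s z) ⊆ T ∩ T'} := by
  classical
  have hTT : T ∪ T' ⊆ A := Finset.union_subset hT hT'
  rw [pocket_eq_event A T s hT, pocket_eq_event A T' s hT', pocket_eq_event A (T ∪ T') s hTT]
  have hsX : s ∉ ((↑A : Set V) \ ↑T) := fun h => hs (Finset.mem_coe.1 h.1)
  have key := bhk_one_mixed w s ((↑A : Set V) \ ↑T) ((↑A : Set V) \ ↑T') hsX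
    (isUpperSet_seesAll s T) (isUpperSet_seesAll s T')
  -- identify the four events
  have eXY : ((↑A : Set V) \ ↑T) ∩ ((↑A : Set V) \ ↑T') = (↑A : Set V) \ ↑(T ∪ T') := by
    ext x; simp only [mem_inter_iff, mem_sdiff, Finset.coe_union, mem_union]; tauto
  have eAB : ({ω : BondConfig V | openEdgeCluster ω s ∈ {C : Set (Sym2 V) | ∀ a ∈ T, C ∈ connFamily s a}} ∩
      {ω | openEdgeCluster ω s ∈ {C : Set (Sym2 V) | ∀ a ∈ T', C ∈ connFamily s a}}) =
      {ω : BondConfig V | openEdgeCluster ω s ∈ {C : Set (Sym2 V) | ∀ a ∈ T ∪ T', C ∈ connFamily s a}} := by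
    ext ω
    simp only [mem_inter_iff, mem_setOf_eq, Finset.mem_union]
    constructor
    · rintro ⟨h1, h2⟩ a ha; rcases ha with ha | ha; exacts [h1 a ha, h2 a ha]
    · intro h; exact ⟨fun a ha => h a (Or.inl ha), fun a ha => h a (Or.inr ha)⟩
  have eU : {ω : BondConfig V | ∀ x ∈ ((↑A : Set V) \ ↑T) ∪ ((↑A : Set V) \ ↑T'), ¬ (openGraph ω).Reachable s x} =
      {ω : BondConfig V | (A.filter fun z => ω ∈ openConn s z) ⊆ T ∩ T'} := by
    ext ω
    simp only [mem_setOf_eq, mem_union, mem_sdiff, Finset.mem_coe]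
    constructor
    · intro h a ha
      rw [Finset.mem_filter] at ha
      rw [Finset.mem_inter]
      constructor
      · by_contra haT; exact h a (Or.inl ⟨ha.1, haT⟩) ha.2
      · by_contra haT; exact h a (Or.inr ⟨ha.1, haT⟩) ha.2
    · intro h x hx hsx
      rcases hx with ⟨hxA, hxT⟩ | ⟨hxA, hxT⟩
      · have := h (Finset.mem_filter.2 ⟨hxA, hsx⟩); rw [Finset.mem_inter] at this; exact hxT this.1
      · have := h (Finset.mem_filter.2 ⟨hxA, hsx⟩); rw [Finset.mem_inter] at this; exact hxT this.2
  rw [eXY, eAB, eU] at key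
  exact key

end MixedAvoidance

end Summit.CriticalPhenomena.PercolationContinuityZ3.Theorems

end
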